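import Summits.CriticalPhenomena.Ising3DConformalLimit.Theorems.CoerciveSharpnessCoerciveReflectedGradientDefs
import Summits.CriticalPhenomena.Ising3DConformalLimit.Theorems.CoerciveSharpnessCoerciveReflectedGradientStubBoxPointwise
import Summits.CriticalPhenomena.Ising3DConformalLimit.Theorems.CoerciveSharpnessCoerciveReflectedGradientStubBoxTorus
import Summits.CriticalPhenomena.Ising3DConformalLimit.Theorems.CoerciveSharpnessCoerciveReflectedGradientStubBoxInfiniteVolume
import Summits.CriticalPhenomena.Ising3DConformalLimit.Theorems.CoerciveSharpnessCoerciveReflectedGradientStubHeadSmall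
import Summits.CriticalPhenomena.Ising3DConformalLimit.Theorems.CoerciveSharpnessCoerciveReflectedGradientStubReflectedSumIdentity
import Summits.CriticalPhenomena.Ising3DConformalLimit.Theorems.CoerciveSharpnessCoerciveReflectedGradientStubGrowthSelection
import Literature.Probability.LatticeModels.CriticalTwoPointLower
import HarnessLib

/-!
# Route `CoerciveSharpness`, crux `CoerciveReflectedGradient` (item stmt-CriticalPhenomena-18197): proof
# along the line `base_box_rerun`

Closing file of the crux: `theorem coerciveReflectedGradient_proof :
Summit.CriticalPhenomena.Ising3DConformalLimit.Theses.CoerciveSharpness.CoerciveReflectedGradient`.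
It is the registered skeleton `Cruxes/CoerciveReflectedGradient/Lines/base_box_rerun.lean` (crux-strategist
planner-cstrat-stmt-CriticalPhenomena-18197-b1-0, lead prover-line-stmt-CriticalPhenomena-18197-0) with its six
registered stubs PROVED in the helper files
`Theorems/CoerciveSharpnessCoerciveReflectedGradientStub{BoxPointwise,BoxTorus,BoxInfiniteVolume,HeadSmall,ReflectedSumIdentity,GrowthSelection}.lean`
(verbatim signatures `Sig.stub_*` of the definitions module `Theorems/CoerciveSharpnessCoerciveReflectedGradientDefs.lean`)
and composed here exactly as in the skeleton's kernel-checked glue `CoerciveReflectedGradient_of`.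

Mathematics (Duminil-Copin–Panis, CMP 406 (2025) = arXiv:2404.05700, §2.2 rerun with a base box): the tree's
proved torus route to Theorem 1.2 (`Literature/Probability/LatticeModels/SharpLengthDCPTorus.lean`) with the base
POINT `0` of the random set `𝒮_n` replaced by the base BOX `Λ_m`: pointwise (stub A) either some `z ∈ Λ_m` is
joined to a mirror hyperplane, or `Λ_m ⊆ 𝒮_n` and the COERCIVE input `PhiCoercive` (weight form,
`w = β_c/(c m^κ)`) runs through the Griffiths comparison; integration on the even torus with Lemma 2.4 at every
base point and Lemma 2.5 (stub B); `L → ∞` at `m*(β) = 0` (stub C); the head `Σ_δ Σ_{z ∈ Λ_m} ⟨σ₀σ_{𝓡_δ z − z}⟩_{β_c}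
≤ C m³/n` by the infrared bound (stub D); direction symmetry and re-indexing to the crux's `Σ_x Σ_i (x ± e_i)`
(stub E); scale selection `m ≍ n^{1/3}`, `κ' = κ/3` (stub F). No definition, no named fact as hypothesis.
-/

noncomputable section

open Finset
open scoped BigOperators Classical

/-! ### Composition: the skeleton's kernel-checked glue `CoerciveReflectedGradient_of`, with the six landed
stubs substituted for its six hypotheses -/

namespace Summit.CriticalPhenomena.Ising3DConformalLimit.Theorems

open Literature.Probability.LatticeModels
open Summit.CriticalPhenomena.Ising3DConformalLimit.Cruxes.CoerciveReflectedGradient.BaseBoxRerun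
open Summit.CriticalPhenomena.Ising3DConformalLimit.Theses.CoerciveSharpness (PhiCoercive CoerciveReflectedGradient)

/-- **Crux `CoerciveReflectedGradient` of route `CoerciveSharpness`, proved** (item stmt-CriticalPhenomena-18197):
coercivity of the sharpness functional at `β_c(3)` upgrades Duminil-Copin–Panis Theorem 1.2 — `PhiCoercive`
implies that the reflected gradient `Q(n) = Σ_{x,y ∈ Λ_n, y∼x} (⟨σ₀σ_x⟩ − ⟨σ₀σ_{𝓡_n x}⟩)⟨σ_yσ_{𝓡_n y}⟩` on `ℤ³` at
`β_c` is `≥ c₀ n^{κ'}` for all large `n`, with `κ' = κ/3`. Proof = the skeleton's glue `CoerciveReflectedGradient_of`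
on the six landed stubs: given `PhiCoercive` with constants `κ, c`, for `1 ≤ m`, `2m ≤ n` put `w := β_c/(c m^κ)`;
then `PhiCoercive` is exactly `BoxInput 3 β_c w m n`, `stub_boxInfiniteVolume (stub_boxTorus stub_boxPointwise)`
gives `1 ≤ head + w · Σ_δ(…)`, `stub_reflectedSumIdentity` rewrites `Σ_δ(…) = 6 Q(n)`, `stub_headSmall` bounds the
head by `C m³/n`, and multiplying by `c m^κ` gives the hypothesis of `stub_growthSelection` with `A = 6β_c`, whose
conclusion is the crux's consequent (`Qcrux n` is its right-hand side by `rfl`). -/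
theorem coerciveReflectedGradient_proof :
    Summit.CriticalPhenomena.Ising3DConformalLimit.Theses.CoerciveSharpness.CoerciveReflectedGradient := by
  intro hφ
  obtain ⟨κ, c, hκ, hc, hcoer⟩ := hφ
  obtain ⟨C, hC0, hhead⟩ := stub_headSmall
  have hIV : BoxInfiniteVolume := stub_boxInfiniteVolume (stub_boxTorus stub_boxPointwise)
  have hβc : 0 < criticalBeta 3 := criticalBeta_pos_holds (d := 3) (by norm_num)
  have hA6 : (0 : ℝ) < 6 * criticalBeta 3 := mul_pos (by norm_num) hβc
  refine stub_growthSelection Qcrux κ c C (6 * criticalBeta 3) hκ hc hC0 hA6 ?_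
  intro m n hm hmn
  have hm0 : 0 < m := hm
  have hmpos : (0 : ℝ) < m := by exact_mod_cast hm0
  have hmκ : 0 < c * (m : ℝ) ^ κ := mul_pos hc (Real.rpow_pos_of_pos hmpos κ)
  set w : ℝ := criticalBeta 3 / (c * (m : ℝ) ^ κ) with hw_def
  have hw : 0 ≤ w := div_nonneg hβc.le hmκ.le
  have hinput : BoxInput 3 (criticalBeta 3) w m n := by
    intro S hmS _hSn
    have h := hcoer m hm S hmS
    rw [hw_def, div_mul_eq_mul_div, le_div_iff₀ hmκ, one_mul]
    exact h
  have h1 := hIV 3 le_rfl (criticalBeta 3) hβc.le le_rfl m n hm (by omega) w hw hinput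
  rw [Finset.sum_add_distrib, ← Finset.mul_sum, stub_reflectedSumIdentity n] at h1
  have h2 := hhead m n hm hmn
  have h3 : (1 : ℝ) ≤ C * (m : ℝ) ^ 3 / (n : ℝ) + w * (6 * Qcrux n) := by linarith
  have h4 := mul_le_mul_of_nonneg_left h3 hmκ.le
  have hkey : c * (m : ℝ) ^ κ * (w * (6 * Qcrux n)) = 6 * criticalBeta 3 * Qcrux n := by
    rw [hw_def]
    field_simp
  calc c * (m : ℝ) ^ κ = c * (m : ℝ) ^ κ * 1 := (mul_one _).symm
    _ ≤ c * (m : ℝ) ^ κ * (C * (m : ℝ) ^ 3 / (n : ℝ) + w * (6 * Qcrux n)) := h4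
    _ = c * (m : ℝ) ^ κ * (C * (m : ℝ) ^ 3 / (n : ℝ)) + 6 * criticalBeta 3 * Qcrux n := by
        rw [mul_add, hkey]

end Summit.CriticalPhenomena.Ising3DConformalLimit.Theorems

end
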